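import Summits.RiemannHypothesis.RiemannHypothesis.Theorems.SuzukiFlowPairingGaussBound
import Summits.RiemannHypothesis.RiemannHypothesis.Theorems.SuzukiFlowPairingPolarPiece

/-!
# Operator side of `FlowPairing`: the Gauss–digamma series through the inner window integral
# (column DBR; RH-FREE)

RH-FREE throughout; nothing here bears on the truth of RH.  With `τ_k(w) = K_θ(w)/(k+1) −
2∫₀^∞e^{−(2k+½)v}K_θ(w−v)dv` (the Gauss–digamma pieces of `Theorems.SuzukiFlowKernelReal.flowKernel_eq`)
and `G = 𝖪_θ[t]f`, `f ∈ L¹(−t,t)`: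

* `continuous_integral_exp_mul_shift` — for continuous `g` bounded on every half-line `(−∞,T]` and
  `a < 0`, `x ↦ ∫₀^∞ e^{av} g(x − v) dv` is continuous (dominated convergence); so the causal exponential
  pieces of `K_θ` and of `G` are continuous (`continuous_gaussWeight_limKernel`, `continuous_gaussWeight_winOp`);
* `exists_abs_winOp_le_of_le` — `G` is bounded on every half-line;
* **`integral_gaussSeries_mul_eq_tsum`** — for `x ≤ t`, the series passes the inner window integral:
  `∫_{(−t,t)} (Σ' k τ_k(x+y)) f(y) dy = Σ' k (G(x)/(k+1) − 2∫₀^∞ e^{−(2k+½)v} G(x−v) dv)`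
  (`integral_tsum_of_summable_integral_norm` with the uniform majorant `Theorems.SuzukiFlowPairingGaussBound`,
  then `winOp_expPiece`).

References: [Su20] M. Suzuki, ASPM 84 (2020); E. Bombieri, Rend. Lincei (9) 11 (2000), §2.
-/

noncomputable section

-- D-0017: `Summit.<S>.<S>.…` is the designed namespace of a single-problem summit.
set_option linter.dupNamespace false

open Complex MeasureTheory Set Filter Topology
open scoped Real

namespace Summit.RiemannHypothesis.RiemannHypothesis.Theorems.SuzukiThetaFlow

open Literature.NumberTheory.LFunctions
open Summit.RiemannHypothesis.RiemannHypothesis.Theorems.SuzukiKernelSemigroup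
open Summit.RiemannHypothesis.RiemannHypothesis.Theorems.SuzukiFlowPairing

variable {θ t : ℝ} {f : ℝ → ℝ}

/-! ## §1 Continuity of causal exponential averages -/

/-- RH-FREE.  **Dominated convergence**: for continuous `g` bounded on every half-line `(−∞,T]` and `a < 0`,
`x ↦ ∫₀^∞ e^{av} g(x − v) dv` is continuous. -/
theorem continuous_integral_exp_mul_shift {g : ℝ → ℝ} (hg : Continuous g)
    (hb : ∀ T : ℝ, ∃ M : ℝ, ∀ w : ℝ, w ≤ T → |g w| ≤ M) {a : ℝ} (ha : a < 0) :
    Continuous fun x : ℝ ↦ ∫ v in Ioi (0 : ℝ), Real.exp (a * v) * g (x - v) := by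
  refine continuous_iff_continuousAt.2 fun x₀ ↦ ?_
  obtain ⟨M, hM⟩ := hb (x₀ + 1)
  have hE : IntegrableOn (fun v : ℝ ↦ Real.exp (a * v)) (Ioi 0) :=
    (exp_neg_integrableOn_Ioi 0 (by linarith : 0 < -a)).congr_fun (fun v _ ↦ by ring_nf) measurableSet_Ioi
  refine continuousAt_of_dominated (bound := fun v ↦ Real.exp (a * v) * M) ?_ ?_ (hE.mul_const M) ?_
  · exact Eventually.of_forall fun x ↦
      ((Real.continuous_exp.comp (by fun_prop)).mul (hg.comp (by fun_prop))).aestronglyMeasurable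
  · have hnhds : Iio (x₀ + 1) ∈ 𝓝 x₀ := Iio_mem_nhds (by linarith)
    filter_upwards [hnhds] with x hx
    refine (ae_restrict_iff' measurableSet_Ioi).2 (Eventually.of_forall fun v hv ↦ ?_)
    rw [norm_mul, Real.norm_eq_abs, Real.norm_eq_abs, Real.abs_exp]
    exact mul_le_mul_of_nonneg_left (hM _ (by linarith [mem_Iio.1 hx, mem_Ioi.1 hv])) (Real.exp_pos _).le
  · exact Eventually.of_forall fun v ↦
      ((continuous_const.mul (hg.comp (continuous_id.sub continuous_const))).continuousAt)

/-- RH-FREE.  The Gauss pieces of `K_θ`, `w ↦ ∫₀^∞ e^{−(2k+½)v}K_θ(w−v)dv`, are continuous. -/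
theorem continuous_gaussWeight_limKernel (hθ : 1 < θ) (k : ℕ) :
    Continuous fun w : ℝ ↦ ∫ v in Ioi (0 : ℝ), Real.exp ((-2 * (k : ℝ) - 1 / 2) * v) * limKernel θ (w - v) :=
  continuous_integral_exp_mul_shift (Suzuki2020_thm12_continuous hθ)
    (fun T ↦ let ⟨M, _, hM⟩ := exists_abs_limKernel_le_of_le hθ T; ⟨M, hM⟩)
    (by have := (Nat.cast_nonneg k : (0 : ℝ) ≤ k); linarith)

/-- RH-FREE.  The output `G = 𝖪_θ[t]f` is bounded on every half-line `(−∞, T]`. -/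
theorem exists_abs_winOp_le_of_le (hθ : 1 < θ) (hf : IntegrableOn f (Ioo (-t) t)) (T : ℝ) :
    ∃ M : ℝ, 0 ≤ M ∧ ∀ x : ℝ, x ≤ T → |winOp (limKernel θ) t f x| ≤ M := by
  obtain ⟨MK, hMK0, hMK⟩ := exists_abs_limKernel_le_of_le hθ (T + t)
  refine ⟨MK * ∫ y in Ioo (-t) t, |f y|, by positivity, fun x hx ↦ ?_⟩
  unfold winOp
  rw [← Real.norm_eq_abs, ← integral_const_mul]
  refine norm_integral_le_of_norm_le (hf.norm.const_mul MK |>.congr (Eventually.of_forall fun y ↦ by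
    simp only [Real.norm_eq_abs])) ?_
  refine (ae_restrict_iff' measurableSet_Ioo).2 (Eventually.of_forall fun y hy ↦ ?_)
  rw [norm_mul, Real.norm_eq_abs, Real.norm_eq_abs]
  exact mul_le_mul_of_nonneg_right (hMK _ (by linarith [hy.2])) (abs_nonneg _)

/-- RH-FREE.  The Gauss pieces of the output, `x ↦ ∫₀^∞ e^{−(2k+½)v}G(x−v)dv`, are continuous. -/
theorem continuous_gaussWeight_winOp (hθ : 1 < θ) (hf : IntegrableOn f (Ioo (-t) t)) (k : ℕ) :
    Continuous fun x : ℝ ↦ ∫ v in Ioi (0 : ℝ), Real.exp ((-2 * (k : ℝ) - 1 / 2) * v) *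
      winOp (limKernel θ) t f (x - v) :=
  continuous_integral_exp_mul_shift (continuous_winOp hθ hf)
    (fun T ↦ let ⟨M, _, hM⟩ := exists_abs_winOp_le_of_le hθ hf T; ⟨M, hM⟩)
    (by have := (Nat.cast_nonneg k : (0 : ℝ) ≤ k); linarith)

/-! ## §2 The series through the inner window integral -/

/-- RH-FREE.  One Gauss piece through the inner window integral:
`∫_{(−t,t)} τ_k(x+y) f(y) dy = G(x)/(k+1) − 2∫₀^∞ e^{−(2k+½)v} G(x−v) dv`. -/
theorem integral_gaussPiece_mul (hθ : 1 < θ) (hf : IntegrableOn f (Ioo (-t) t)) (k : ℕ) (x : ℝ) :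
    ∫ y in Ioo (-t) t, (limKernel θ (x + y) / ((k : ℝ) + 1) -
        2 * ∫ v in Ioi (0 : ℝ), Real.exp ((-2 * (k : ℝ) - 1 / 2) * v) * limKernel θ (x + y - v)) * f y =
      winOp (limKernel θ) t f x / ((k : ℝ) + 1) -
        2 * ∫ v in Ioi (0 : ℝ), Real.exp ((-2 * (k : ℝ) - 1 / 2) * v) * winOp (limKernel θ) t f (x - v) := by
  have h1 : IntegrableOn (fun y ↦ limKernel θ (x + y) * f y) (Ioo (-t) t) := integrableOn_kernel_mul hθ hf x
  -- the exponential piece: bounded continuous factor times `f`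
  obtain ⟨MK, -, hMK⟩ := exists_abs_limKernel_le_of_le hθ (x + t)
  have hr : (0 : ℝ) < 2 * k + 1 / 2 := by positivity
  have hEv : ∫ v in Ioi (0 : ℝ), Real.exp ((-2 * (k : ℝ) - 1 / 2) * v) = 1 / (2 * (k : ℝ) + 1 / 2) := by
    have h := Real.integral_rpow_mul_exp_neg_mul_Ioi (a := 1) (r := 2 * (k : ℝ) + 1 / 2) one_pos hr
    rw [sub_self, Real.rpow_one, Real.Gamma_one, mul_one] at h
    rw [← h]
    refine setIntegral_congr_fun measurableSet_Ioi fun v _ ↦ ?_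
    rw [Real.rpow_zero, one_mul]
    ring_nf
  have hPb : ∀ y : ℝ, y ∈ Ioo (-t) t →
      |∫ v in Ioi (0 : ℝ), Real.exp ((-2 * (k : ℝ) - 1 / 2) * v) * limKernel θ (x + y - v)| ≤
        MK * (1 / (2 * (k : ℝ) + 1 / 2)) := by
    intro y hy
    rw [← hEv, ← integral_const_mul, ← Real.norm_eq_abs]
    have hE : IntegrableOn (fun v : ℝ ↦ Real.exp ((-2 * (k : ℝ) - 1 / 2) * v)) (Ioi 0) :=
      (exp_neg_integrableOn_Ioi 0 hr).congr_fun (fun v _ ↦ by ring_nf) measurableSet_Ioi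
    refine norm_integral_le_of_norm_le (hE.const_mul MK) ?_
    refine (ae_restrict_iff' measurableSet_Ioi).2 (Eventually.of_forall fun v hv ↦ ?_)
    rw [norm_mul, Real.norm_eq_abs, Real.norm_eq_abs, Real.abs_exp]
    calc Real.exp ((-2 * (k : ℝ) - 1 / 2) * v) * |limKernel θ (x + y - v)|
        ≤ Real.exp ((-2 * (k : ℝ) - 1 / 2) * v) * MK :=
          mul_le_mul_of_nonneg_left (hMK _ (by linarith [hy.2, mem_Ioi.1 hv])) (Real.exp_pos _).le
      _ = MK * Real.exp ((-2 * (k : ℝ) - 1 / 2) * v) := mul_comm _ _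
  have h2 : IntegrableOn (fun y ↦ (∫ v in Ioi (0 : ℝ), Real.exp ((-2 * (k : ℝ) - 1 / 2) * v) *
      limKernel θ (x + y - v)) * f y) (Ioo (-t) t) := by
    have hc : Continuous fun y : ℝ ↦ ∫ v in Ioi (0 : ℝ), Real.exp ((-2 * (k : ℝ) - 1 / 2) * v) *
        limKernel θ (x + y - v) :=
      (continuous_gaussWeight_limKernel hθ k).comp (continuous_const.add continuous_id)
    refine Integrable.bdd_mul (c := MK * (1 / (2 * (k : ℝ) + 1 / 2))) hf hc.aestronglyMeasurable ?_
    exact (ae_restrict_iff' measurableSet_Ioo).2 (Eventually.of_forall fun y hy ↦ by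
      rw [Real.norm_eq_abs]; exact hPb y hy)
  have hsplit : (fun y ↦ (limKernel θ (x + y) / ((k : ℝ) + 1) -
      2 * ∫ v in Ioi (0 : ℝ), Real.exp ((-2 * (k : ℝ) - 1 / 2) * v) * limKernel θ (x + y - v)) * f y) =
      fun y ↦ (1 / ((k : ℝ) + 1)) * (limKernel θ (x + y) * f y) -
        2 * ((∫ v in Ioi (0 : ℝ), Real.exp ((-2 * (k : ℝ) - 1 / 2) * v) * limKernel θ (x + y - v)) * f y) := by
    funext y; ring
  rw [hsplit, integral_sub (h1.const_mul _) (h2.const_mul _), integral_const_mul, integral_const_mul,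
    winOp_expPiece hθ hf]
  unfold winOp
  ring

/-- **RH-FREE · the Gauss–digamma series through the inner window integral**: for `θ > 1`,
`f ∈ L¹(−t,t)` and `x ≤ t`,
`∫_{(−t,t)} (Σ' k τ_k(x+y)) f(y) dy = Σ' k (G(x)/(k+1) − 2∫₀^∞ e^{−(2k+½)v} G(x−v) dv)`,
`τ_k(w) = K_θ(w)/(k+1) − 2∫₀^∞e^{−(2k+½)v}K_θ(w−v)dv`, `G = 𝖪_θ[t]f`.  Nothing here bears on RH. -/
theorem integral_gaussSeries_mul_eq_tsum (hθ : 1 < θ) (hf : IntegrableOn f (Ioo (-t) t)) {x : ℝ} (hx : x ≤ t) :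
    ∫ y in Ioo (-t) t, (∑' k : ℕ, (limKernel θ (x + y) / ((k : ℝ) + 1) -
        2 * ∫ v in Ioi (0 : ℝ), Real.exp ((-2 * (k : ℝ) - 1 / 2) * v) * limKernel θ (x + y - v))) * f y =
      ∑' k : ℕ, (winOp (limKernel θ) t f x / ((k : ℝ) + 1) -
        2 * ∫ v in Ioi (0 : ℝ), Real.exp ((-2 * (k : ℝ) - 1 / 2) * v) * winOp (limKernel θ) t f (x - v)) := by
  obtain ⟨M, C, ε, hM0, hC, hε0, -, hτ⟩ := abs_gaussPiece_le hθ (2 * |t|)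
  have hsum := summable_archSeriesMajorant M C ε hε0
  set F : ℕ → ℝ → ℝ := fun k y ↦ (limKernel θ (x + y) / ((k : ℝ) + 1) -
    2 * ∫ v in Ioi (0 : ℝ), Real.exp ((-2 * (k : ℝ) - 1 / 2) * v) * limKernel θ (x + y - v)) * f y with hF
  have hτc : ∀ k : ℕ, Continuous fun y : ℝ ↦ limKernel θ (x + y) / ((k : ℝ) + 1) -
      2 * ∫ v in Ioi (0 : ℝ), Real.exp ((-2 * (k : ℝ) - 1 / 2) * v) * limKernel θ (x + y - v) := fun k ↦
    (((Suzuki2020_thm12_continuous hθ).comp (continuous_const.add continuous_id)).div_const _).sub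
      (continuous_const.mul ((continuous_gaussWeight_limKernel hθ k).comp (continuous_const.add continuous_id)))
  have hbd : ∀ k : ℕ, ∀ y ∈ Ioo (-t) t, ‖limKernel θ (x + y) / ((k : ℝ) + 1) -
      2 * ∫ v in Ioi (0 : ℝ), Real.exp ((-2 * (k : ℝ) - 1 / 2) * v) * limKernel θ (x + y - v)‖ ≤
      4 * π * (3 * M / ((k : ℝ) + 1) ^ 2 +
        (2 * C + 4 * M) * Real.Gamma (ε + 1) * (1 / (2 * (k : ℝ) + 1 / 2)) ^ (ε + 1)) := by
    intro k y hy
    rw [Real.norm_eq_abs]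
    exact hτ (x + y) (by linarith [hy.2, le_abs_self t]) k
  have hFi : ∀ k, Integrable (F k) (volume.restrict (Ioo (-t) t)) := fun k ↦
    Integrable.bdd_mul hf (hτc k).aestronglyMeasurable
      ((ae_restrict_iff' measurableSet_Ioo).2 (Eventually.of_forall (hbd k)))
  have hFs : Summable fun k ↦ ∫ y in Ioo (-t) t, ‖F k y‖ := by
    refine (hsum.mul_right (∫ y in Ioo (-t) t, |f y|)).of_nonneg_of_le
      (fun k ↦ integral_nonneg fun _ ↦ norm_nonneg _) fun k ↦ ?_
    rw [← integral_const_mul]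
    refine integral_mono_of_nonneg (Eventually.of_forall fun _ ↦ norm_nonneg _) (hf.abs.const_mul _) ?_
    refine (ae_restrict_iff' measurableSet_Ioo).2 (Eventually.of_forall fun y hy ↦ ?_)
    simp only [hF, norm_mul, Real.norm_eq_abs]
    have h := hbd k y hy
    rw [Real.norm_eq_abs] at h
    exact mul_le_mul_of_nonneg_right h (abs_nonneg _)
  have h := integral_tsum_of_summable_integral_norm hFi hFs
  have hlhs : ∫ y in Ioo (-t) t, (∑' k : ℕ, (limKernel θ (x + y) / ((k : ℝ) + 1) -
      2 * ∫ v in Ioi (0 : ℝ), Real.exp ((-2 * (k : ℝ) - 1 / 2) * v) * limKernel θ (x + y - v))) * f y =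
      ∫ y in Ioo (-t) t, ∑' k : ℕ, F k y := by
    refine setIntegral_congr_fun measurableSet_Ioo fun y _ ↦ ?_
    rw [← tsum_mul_right]
  rw [hlhs, ← h]
  exact tsum_congr fun k ↦ integral_gaussPiece_mul hθ hf k x

end Summit.RiemannHypothesis.RiemannHypothesis.Theorems.SuzukiThetaFlow

end
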